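import Mathlib
import HarnessLib
import Summits.Langlands.Langlands.Theses.SkinnerWilesDefectOne
import Summits.Langlands.Langlands.Theorems.EisensteinProModularSeed.Negative.OrientedFrame
import Summits.Langlands.Langlands.Theorems.EisensteinProModularSeed.Negative.BorelAndEisenstein
import Literature.NumberTheory.Automorphic.CuspidalCohomologyGLHecke
import Literature.NumberTheory.Automorphic.OrdinaryCompletedCohomologyGL
import Literature.RingTheory.DiscreteValuationRing.DeligneSerreEigenvectorLift

/-!
# Line `parallel-h2-eisenstein-symbol` — crux-plan skeleton for `EisensteinProModularSeed`
# (stmt-Langlands-12920, route SkinnerWilesDefectOne, rank 3)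

Crux (FIXED, the route's decl):
`Summit.Langlands.Langlands.Theses.SkinnerWilesDefectOne.EisensteinProModularSeed`.

THE LINE (idea card `Ideas/parallel-h2-eisenstein-symbol.md`, triage r1-1/2/3 all pass): the seed
asks (Disproof `concl_eisenstein_congruence`, `concl_orientation_residual`) for a characteristic-0,
PARALLEL-weight, ordinary cuspidal eigensystem of the Bianchi tower, Eisenstein-congruent to the
ORDERED residual pair `(χ̄_a, χ̄_b)` with the uniform Skinner–Wiles orientation (unit root `≡ χ̄_a`
at EVERY `v ∣ p`), at tame level `cond(χ̄)·q` for ONE auxiliary place `q`.  Parallel Eisenstein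
systems live in degrees 0/2 of Bianchi cohomology; in degree 2 the cokernel of restriction to the
Borel–Serre boundary injects into `H³_c ≅ H₀`, torsion-free, so a congruence of the degree-2
Eisenstein class with the INTERIOR (= cuspidal) lattice modulo `𝔪` (equivalently `p ∣ δ₂`, the
Betti denominator) is exactly what is needed; Deligne–Serre (tree: `lemma611_holds`) lifts it to
characteristic 0 and the automorphic-to-Galois dictionary produces the seed `r`.

SKELETON (4 registered stubs + the composition `EisensteinProModularSeed_of`, weight `k' = 2`):
* `stub_window`      — LOAD-BEARING (the card's Transfer `C⁺`, post exit-lemma form): for every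
                        admissible datum there are a tame level `𝒰` (maximal above `p`, hyperspecial
                        off `cond(χ̄)·q`, ONE `q`), a Hida exponent `r`, the idelic avatar `η` of
                        `χ̄_a`, and an INTERIOR weight-2 class `c ∈ H²_!(X_{U(r)}, O)`, primitive modulo
                        `𝔪 H² + torsion`, on which `T_{w,1}` acts by `χ_a + χ_b (Frob_w)` and every
                        `[U(r) t_v(ϖ') U(r)]` (`v ∣ p`, all uniformisers `ϖ'`) by `η(ι_v ϖ')`, mod `𝔪 H²`
                        ("the mod-`p` parallel Eisenstein line meets the reduction of the interior
                        lattice" = torsion-free Ihara at the Eisenstein line).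
* `stub_lift`        — Deligne–Serre on the torsion-free interior Bianchi lattice (finiteness,
                        saturation, commutativity of the Hida operators): a genuine non-torsion
                        interior simultaneous eigenclass `c'` with eigenvalues `≡` the targets.
* `stub_galois`      — automorphic → Galois for a weight-2 interior Bianchi eigenclass: `r`
                        irreducible (Jacquet–Shalika), `𝒰.IsPadicallyAutomorphic r` (points of the
                        big Hecke algebra from finite-level eigenclasses), `tr r(Frob_w) = b_w`.
* `stub_orientation` — ordinary local–global compatibility at `v ∣ p` for that `r` (unit root
                        `= U`-eigenvalue, arithmetic normalisation), global reciprocity for `η`,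
                        Ribet's lattice with `χ̄_a` as SUB, and the LANDED converse orientation lemma
                        `Negative.oriented_of_unitRoot_congr_toLocal` ⟹ the oriented clause, `k' = 2`.
Each stub is stated over tree declarations only (`TwistedQuotient.cohomology/interiorCohomology/
heckeEnd` of `CuspidalCohomologyGL(Hecke)`, `TameLevel.hidaLevel`, `heckeElement`, `glDiagonal`,
`uniformizerIdele`, `IsPadicallyAutomorphic`, `IsArithFrobAt`, `IsPDistinguishedAt`, …); the model
`P` of the Tits building `ℙ¹(F)` is quantified (`P ≃o` proper non-zero subspaces of `F²`,
equivariantly) and instantiated in `EisensteinProModularSeed_of` by `ProperLine F` below.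

Disproof used: no `_false_without_` theorem exists (cdisprove gen 2).  Honoured: the chain never
uses a hypothesis on `ρ` beyond the pair and `p`-distinguishedness (`crux_iff_pairSeedArising`);
the level clause is produced by `stub_window` verbatim (`seedNoLevel_of_engine`: it is the whole
content); `stub_lift` outputs a NON-TORSION class (`eigensystem_apply_eq_zero_of_nsmul_eq_zero`);
orientation is discharged through the landed `oriented_of_unitRoot_congr_toLocal` (imported).
No stub is an instance of a landed Negative lemma's negation (both Negative files are imported in
this check).
-/

set_option linter.dupNamespace false
set_option linter.unusedVariables false

namespace Summit.Langlands.Langlands.Cruxes.EisensteinProModularSeed.ParallelH2EisensteinSymbol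

open Summit.Langlands.Langlands.Theses.SkinnerWilesDefectOne
open Literature.NumberTheory.Automorphic Literature.NumberTheory.Automorphic.BigHeckeGLn
open Literature.NumberTheory.GaloisRepresentations
open NumberField IsDedekindDomain IsLocalRing Filter Field
open scoped MatrixGroups Matrix

/-! ## The registered stubs -/

/-- **stub_window (LOAD-BEARING; the card's Transfer `C⁺` in post-exit-lemma form).**  For every
admissible datum of the crux and every model `P` of the Tits building `ℙ¹(F)`: there are a tame
level `𝒰` maximal above `p` and hyperspecial at every `v ≠ q`, `v ∤ p` where both residual
characters are unramified (ONE auxiliary place `q`), a Hida exponent `r`, a finite-order idelic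
character `η` (open kernel, trivial on `Fˣ`) matching `χ_a = (ρ₀)₀₀` at the good arithmetic
Frobenii, and an INTERIOR class `c` of `H²(X_{U(r)}, O)` (weight 2, trivial coefficients) which is
primitive modulo `𝔪 H² + torsion` and is a Hecke eigenvector MODULO `𝔪 H²` with the parallel
Eisenstein eigenvalues: `T_{w,1} ↦ χ_a(Frob_w) + χ_b(Frob_w)` (`w ∉ 𝒰.bad`) and, at `v ∣ p`, every
`[U(r) t_v(ϖ') U(r)]` (`t_v(ϖ') = diag(ϖ', 1)` at `v`, all uniformisers `ϖ'`) `↦ η(ι_v ϖ')` — the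
unit-root side is the `a`-side ("torsion-free Ihara at the parallel Eisenstein line": by the exit
lemma this is `p ∣ δ₂(cond·q·p^r)`).  Sources: card §(2)–(3); Harder 1987; Calegari–Venkatesh
arXiv:1212.3847 §8–9; Berger arXiv:math/0701177 p. 4; triage r1-1 App. A (S+ sign). -/
theorem stub_window : ∀ (F : Type) [Field F] [NumberField F], IsTotallyComplex F →
    Module.finrank ℚ F = 2 → ∀ (p : ℕ) [Fact p.Prime], p ≠ 2 →
    ∀ (O : ValuationSubring (PadicAlgCl p)),
    O = (Valued.v : Valuation (PadicAlgCl p) NNReal).valuationSubring →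
    ∀ (ρ : FramedGaloisRep F (PadicAlgCl p) 2) (ρ₀ : absoluteGaloisGroup F →* GL (Fin 2) O),
    ρ.toGaloisRep.IsIrreducible → (∀ᶠ v in cofinite, ρ.IsUnramifiedAt v) →
    ρ.HasUpperTriangularIntegralModel ρ₀ →
    (∃ k : ℕ, 2 ≤ k ∧ ∃ m : ℕ, 0 < m ∧ ∀ v : HeightOneSpectrum (𝓞 F), (p : 𝓞 F) ∈ v.asIdeal →
      IsPDistinguishedAt ρ₀ v ∧ ∃ Q : GL (Fin 2) (PadicAlgCl p),
        Valued.v (Q.val 0 0) ≤ Valued.v (Q.val 1 0) ∧ ∀ σ, (Q⁻¹ * ρ.toLocal v σ * Q).val 1 0 = 0 ∧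
        (σ ∈ absInertia (v.adicCompletion F) → (Q⁻¹ * ρ.toLocal v σ * Q).val 1 1 ^ m = 1 ∧
          (Q⁻¹ * ρ.toLocal v σ * Q).val 0 0 ^ m = algebraMap ℚ_[p] (PadicAlgCl p)
            (((GaloisRep.cyclotomicCharacter (v.adicCompletion F) p σ).val : ℤ_[p]) : ℚ_[p]) ^
              ((k - 1) * m))) →
    ∀ (P : Type) [PartialOrder P] [MulAction (GL (Fin 2) F) P]
      (hP : ∀ γ : GL (Fin 2) F, Monotone fun x : P => γ • x),
    (∃ e : P ≃o {W : Submodule F (Fin 2 → F) // W ≠ ⊥ ∧ W ≠ ⊤},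
      ∀ (γ : GL (Fin 2) F) (x : P), (e (γ • x)).1 = (e x).1.map (Matrix.mulVecLin γ.1)) →
    ∃ (𝒰 : TameLevel 2 F p) (q : HeightOneSpectrum (𝓞 F)) (r : ℕ)
      (η : (FiniteAdeleRing (𝓞 F) F)ˣ →* Oˣ)
      (c : TwistedQuotient.cohomology (globalEmbedding 2 F) (𝒰.hidaLevel r)
        (Representation.trivial O (GL (Fin 2) F) O) 2),
      𝒰.IsMaximalAbove ∧
      (∀ (x : FiniteAdelicGL 2 F) (γ : GL (Fin 2) F),
        x⁻¹ * globalEmbedding 2 F γ * x ∈ 𝒰.hidaLevel r → IsOfFinOrder γ → γ = 1) ∧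
      (∀ v : HeightOneSpectrum (𝓞 F), v ≠ q → (p : 𝓞 F) ∉ v.asIdeal →
        (∀ 𝔓 ∈ v.primesAbove, ∀ σ ∈ 𝔓.inertia (absoluteGaloisGroup F),
          ((ρ₀ σ).val 0 0 - 1 : O) ∈ maximalIdeal O ∧ ((ρ₀ σ).val 1 1 - 1 : O) ∈ maximalIdeal O) →
        v ∉ 𝒰.bad) ∧
      IsOpen (η.ker : Set (FiniteAdeleRing (𝓞 F) F)ˣ) ∧
      (∀ x : Fˣ, η (Units.map (algebraMap F (FiniteAdeleRing (𝓞 F) F)).toMonoidHom x) = 1) ∧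
      (∀ w ∉ 𝒰.bad, ∀ 𝔓 ∈ w.primesAbove, ∀ σ : absoluteGaloisGroup F, IsArithFrobAt (𝓞 F) σ 𝔓 →
        ((η (uniformizerIdele F w (uniformizerAt w)) : O) - (ρ₀ σ).val 0 0 : O) ∈ maximalIdeal O) ∧
      c ∈ TwistedQuotient.interiorCohomology (globalEmbedding 2 F) (𝒰.hidaLevel r)
        (Representation.trivial O (GL (Fin 2) F) O) P hP 2 ∧
      c ∉ maximalIdeal O • (⊤ : Submodule O _) ⊔ Submodule.torsion O _ ∧
      (∀ w ∉ 𝒰.bad, ∀ 𝔓 ∈ w.primesAbove, ∀ σ : absoluteGaloisGroup F, IsArithFrobAt (𝓞 F) σ 𝔓 →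
        TwistedQuotient.heckeEnd (globalEmbedding 2 F) (𝒰.hidaLevel r)
          (Representation.trivial O (GL (Fin 2) F) O) (heckeElement 2 F w 1) 2 c -
          ((ρ₀ σ).val 0 0 + (ρ₀ σ).val 1 1) • c ∈ maximalIdeal O • (⊤ : Submodule O _)) ∧
      (∀ v : HeightOneSpectrum (𝓞 F), (p : 𝓞 F) ∈ v.asIdeal → ∀ ϖ : (v.adicCompletion F)ˣ,
        Valued.v (ϖ : v.adicCompletion F) = WithZero.exp (-1 : ℤ) →
        TwistedQuotient.heckeEnd (globalEmbedding 2 F) (𝒰.hidaLevel r)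
          (Representation.trivial O (GL (Fin 2) F) O)
          (glDiagonal 2 (FiniteAdeleRing (𝓞 F) F)
            (fun i => if i.val < 1 then uniformizerIdele F v ϖ else 1)) 2 c -
          ((η (uniformizerIdele F v ϖ) : Oˣ) : O) • c ∈ maximalIdeal O • (⊤ : Submodule O _)) := by
  sorry

/-- **stub_lift (Deligne–Serre on the torsion-free interior Bianchi lattice).**  At a Hida level
`U(r)` of a tame level `𝒰` maximal above `p`: if an interior class `c` of `H²(X_{U(r)}, O)`,
primitive modulo `𝔪 H² + torsion`, is an eigenvector modulo `𝔪 H²` of prescribed Hecke operators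
with prescribed residual targets (a target relation `A g ⊆ O`), then there is a NON-TORSION interior
class `c'` which is a genuine simultaneous eigenvector of all the Hida operators `[U(r) t_{w,i} U(r)]`
(`w ∉ 𝒰.bad`) and `[U(r) t_v(ϖ') U(r)]` (`v ∣ p`, uniformisers `ϖ'`), with eigenvalues congruent to
every prescribed target.  Content: descent of `c` and the operators to some `𝒪_E`; finiteness of
`H²` of the Bianchi orbifold (Borel–Serre); saturation of the interior lattice (boundary `H²`
torsion-free for `p` odd); Hecke-stability of `H²_!` (tree `heckeEnd_mem_interiorCohomology`);
commutativity of the Hida operators; the tree's `DeligneSerre1974.lemma611_holds` on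
`H²_!(X_{U(r)}, 𝒪_E)_{tf}`; clearing torsion to get an honest eigenvector.  Sources:
Deligne–Serre 1974 Lemme 6.11; Hida 1993/1994 (control in degrees 1–2); Schwermer 2010 §5.3. -/
theorem stub_lift : ∀ (F : Type) [Field F] [NumberField F], IsTotallyComplex F →
    Module.finrank ℚ F = 2 → ∀ (p : ℕ) [Fact p.Prime], p ≠ 2 →
    ∀ (O : ValuationSubring (PadicAlgCl p)),
    O = (Valued.v : Valuation (PadicAlgCl p) NNReal).valuationSubring →
    ∀ (P : Type) [PartialOrder P] [MulAction (GL (Fin 2) F) P]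
      (hP : ∀ γ : GL (Fin 2) F, Monotone fun x : P => γ • x),
    (∃ e : P ≃o {W : Submodule F (Fin 2 → F) // W ≠ ⊥ ∧ W ≠ ⊤},
      ∀ (γ : GL (Fin 2) F) (x : P), (e (γ • x)).1 = (e x).1.map (Matrix.mulVecLin γ.1)) →
    ∀ (𝒰 : TameLevel 2 F p) (r : ℕ), 𝒰.IsMaximalAbove →
    (∀ (x : FiniteAdelicGL 2 F) (γ : GL (Fin 2) F),
      x⁻¹ * globalEmbedding 2 F γ * x ∈ 𝒰.hidaLevel r → IsOfFinOrder γ → γ = 1) →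
    ∀ (A : FiniteAdelicGL 2 F → Set O),
    (∃ c : TwistedQuotient.cohomology (globalEmbedding 2 F) (𝒰.hidaLevel r)
        (Representation.trivial O (GL (Fin 2) F) O) 2,
      c ∈ TwistedQuotient.interiorCohomology (globalEmbedding 2 F) (𝒰.hidaLevel r)
        (Representation.trivial O (GL (Fin 2) F) O) P hP 2 ∧
      c ∉ maximalIdeal O • (⊤ : Submodule O _) ⊔ Submodule.torsion O _ ∧
      ∀ g : FiniteAdelicGL 2 F, ∀ a ∈ A g,
        TwistedQuotient.heckeEnd (globalEmbedding 2 F) (𝒰.hidaLevel r)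
          (Representation.trivial O (GL (Fin 2) F) O) g 2 c - a • c ∈
          maximalIdeal O • (⊤ : Submodule O _)) →
    ∃ c' : TwistedQuotient.cohomology (globalEmbedding 2 F) (𝒰.hidaLevel r)
        (Representation.trivial O (GL (Fin 2) F) O) 2,
      c' ∈ TwistedQuotient.interiorCohomology (globalEmbedding 2 F) (𝒰.hidaLevel r)
        (Representation.trivial O (GL (Fin 2) F) O) P hP 2 ∧
      (∀ a : O, a • c' = 0 → a = 0) ∧
      ∀ g : FiniteAdelicGL 2 F,
        ((∃ w ∉ 𝒰.bad, ∃ i : ℕ, g = heckeElement 2 F w i) ∨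
          (∃ v : HeightOneSpectrum (𝓞 F), (p : 𝓞 F) ∈ v.asIdeal ∧ ∃ ϖ : (v.adicCompletion F)ˣ,
            Valued.v (ϖ : v.adicCompletion F) = WithZero.exp (-1 : ℤ) ∧
            g = glDiagonal 2 (FiniteAdeleRing (𝓞 F) F)
              (fun i => if i.val < 1 then uniformizerIdele F v ϖ else 1))) →
        ∃ b : O, TwistedQuotient.heckeEnd (globalEmbedding 2 F) (𝒰.hidaLevel r)
            (Representation.trivial O (GL (Fin 2) F) O) g 2 c' = b • c' ∧
          ∀ a ∈ A g, (b - a : O) ∈ maximalIdeal O := by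
  sorry

/-- **stub_galois (automorphic → Galois for weight-2 interior Bianchi eigenclasses).**  A
non-torsion INTERIOR class of `H²(X_{U(r)}, O)` which is a simultaneous eigenvector of the spherical
`T_{w,i}` (`w ∉ 𝒰.bad`) with eigenvalues `b w i` comes from a cuspidal automorphic representation of
`GL₂(𝔸_F)` of parallel weight 2 (interior = cuspidal in degree 2; Harder, Borel), hence carries a
continuous `r : Γ_F → GL₂(ℚ̄_p)` (Harris–Soudry–Taylor, Taylor, Berger–Harcos, Mok; Scholze)
unramified at `w ∉ 𝒰.bad` with `tr r(Frob_w) = b w 1` (arithmetic Frobenius, the tree's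
`IsAssociated` convention), IRREDUCIBLE (Jacquet–Shalika: a cuspidal eigensystem is not an isobaric
sum), and `p`-ADICALLY AUTOMORPHIC of tame level `𝒰` (pull back to the `p`-power tower
`𝒰.tower ≥ U(r)`-levels, reduce modulo `p^s`, `CompletedCohomologyPoints.exists_algHom`, complete in
`𝒪_E`).  Sources: Taylor 1994; Berger–Harcos 2007; Mok 2014; Scholze 2015 §V.4; Calegari–Emerton
2012 §8; Jacquet–Shalika 1981. -/
theorem stub_galois : ∀ (F : Type) [Field F] [NumberField F], IsTotallyComplex F →
    Module.finrank ℚ F = 2 → ∀ (p : ℕ) [Fact p.Prime], p ≠ 2 →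
    ∀ (O : ValuationSubring (PadicAlgCl p)),
    O = (Valued.v : Valuation (PadicAlgCl p) NNReal).valuationSubring →
    ∀ (P : Type) [PartialOrder P] [MulAction (GL (Fin 2) F) P]
      (hP : ∀ γ : GL (Fin 2) F, Monotone fun x : P => γ • x),
    (∃ e : P ≃o {W : Submodule F (Fin 2 → F) // W ≠ ⊥ ∧ W ≠ ⊤},
      ∀ (γ : GL (Fin 2) F) (x : P), (e (γ • x)).1 = (e x).1.map (Matrix.mulVecLin γ.1)) →
    ∀ (𝒰 : TameLevel 2 F p) (r : ℕ), 𝒰.IsMaximalAbove →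
    ∀ (c' : TwistedQuotient.cohomology (globalEmbedding 2 F) (𝒰.hidaLevel r)
        (Representation.trivial O (GL (Fin 2) F) O) 2),
    c' ∈ TwistedQuotient.interiorCohomology (globalEmbedding 2 F) (𝒰.hidaLevel r)
        (Representation.trivial O (GL (Fin 2) F) O) P hP 2 →
    (∀ a : O, a • c' = 0 → a = 0) →
    ∀ (b : HeightOneSpectrum (𝓞 F) → ℕ → O),
    (∀ w ∉ 𝒰.bad, ∀ i : ℕ,
      TwistedQuotient.heckeEnd (globalEmbedding 2 F) (𝒰.hidaLevel r)
        (Representation.trivial O (GL (Fin 2) F) O) (heckeElement 2 F w i) 2 c' = b w i • c') →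
    ∃ r' : FramedGaloisRep F (PadicAlgCl p) 2,
      r'.toGaloisRep.IsIrreducible ∧ 𝒰.IsPadicallyAutomorphic r' ∧
      ∀ w ∉ 𝒰.bad, ∀ 𝔓 ∈ w.primesAbove, ∀ σ : absoluteGaloisGroup F, IsArithFrobAt (𝓞 F) σ 𝔓 →
        (r' σ).val.trace = ((b w 1 : O) : PadicAlgCl p) := by
  sorry

/-- **stub_orientation (ordinary local–global compatibility at `p`, Ribet's lattice, and the landed
orientation lemma).**  Let `r'` be irreducible, `p`-adically automorphic of tame level `𝒰`, with
`tr r'(Frob_w) = b w 1` the `T_{w,1}`-eigenvalues of a non-torsion interior weight-2 class `c'` at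
Hida level `U(r)` whose eigenvalues are `≡ χ_a + χ_b (Frob_w)` and whose `[U(r) t_v(ϖ') U(r)]`-
eigenvalues (`v ∣ p`, every uniformiser `ϖ'`) are `≡ η(ι_v ϖ')` for a finite-order idelic character
`η` matching `χ_a = (ρ₀)₀₀` at good Frobenii; assume the residual pair is `p`-distinguished.  Then:
`r̄'^ss = χ̄_a ⊕ χ̄_b` (Chebotarev + Brauer–Nesbitt, `p` odd); after re-framing (free on the
automorphic side, Disproof `isPadicallyAutomorphic_conj_iff`) Ribet's lattice gives an integral model
`r₀` upper-triangular mod `𝔪` with `χ̄_a` as SUB and the same ordered residual diagonal as `ρ₀`;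
`r'` is ordinary at every `v ∣ p` of parallel weight 2 with unit-root character `θ₂`,
`θ₂(Art_v ϖ') =` the `t_v(ϖ')`-eigenvalue (Hida / Wiles normalisation, arithmetic Frobenius), and
global reciprocity for `η` gives `θ̄₂ = χ̄_a|_{D_v}`; the landed
`Negative.oriented_of_unitRoot_congr_toLocal` then yields the ORIENTED clause `‖Q₀₀‖ ≤ ‖Q₁₀‖`.
Why it might fail: ordinary local–global compatibility at `v ∣ p` for Eisenstein-congruent classical
Bianchi forms (known: automorphic ⇒ Galois up to ss, Caraiani–Newton 2023 Thm 4.2.15, Hevesi,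
A'Campo; the `U_{v,1} = [Iw diag(ϖ,1) Iw]` convention of `OrdinaryCompletedCohomologyGL` must be the
contracting one).  Sources: Wiles 1988 Thm 2.2; Hida 1993/1994; Ribet 1976 Prop. 2.1;
Caraiani–Newton arXiv:2301.10509 §4.2; SkinnerWiles1999 §3 (3.2). -/
theorem stub_orientation : ∀ (F : Type) [Field F] [NumberField F], IsTotallyComplex F →
    Module.finrank ℚ F = 2 → ∀ (p : ℕ) [Fact p.Prime], p ≠ 2 →
    ∀ (O : ValuationSubring (PadicAlgCl p)),
    O = (Valued.v : Valuation (PadicAlgCl p) NNReal).valuationSubring →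
    ∀ (ρ : FramedGaloisRep F (PadicAlgCl p) 2) (ρ₀ : absoluteGaloisGroup F →* GL (Fin 2) O),
    ρ.HasUpperTriangularIntegralModel ρ₀ →
    (∀ v : HeightOneSpectrum (𝓞 F), (p : 𝓞 F) ∈ v.asIdeal → IsPDistinguishedAt ρ₀ v) →
    ∀ (P : Type) [PartialOrder P] [MulAction (GL (Fin 2) F) P]
      (hP : ∀ γ : GL (Fin 2) F, Monotone fun x : P => γ • x),
    (∃ e : P ≃o {W : Submodule F (Fin 2 → F) // W ≠ ⊥ ∧ W ≠ ⊤},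
      ∀ (γ : GL (Fin 2) F) (x : P), (e (γ • x)).1 = (e x).1.map (Matrix.mulVecLin γ.1)) →
    ∀ (𝒰 : TameLevel 2 F p) (r : ℕ), 𝒰.IsMaximalAbove →
    ∀ (η : (FiniteAdeleRing (𝓞 F) F)ˣ →* Oˣ), IsOpen (η.ker : Set (FiniteAdeleRing (𝓞 F) F)ˣ) →
    (∀ x : Fˣ, η (Units.map (algebraMap F (FiniteAdeleRing (𝓞 F) F)).toMonoidHom x) = 1) →
    (∀ w ∉ 𝒰.bad, ∀ 𝔓 ∈ w.primesAbove, ∀ σ : absoluteGaloisGroup F, IsArithFrobAt (𝓞 F) σ 𝔓 →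
      ((η (uniformizerIdele F w (uniformizerAt w)) : O) - (ρ₀ σ).val 0 0 : O) ∈ maximalIdeal O) →
    ∀ (c' : TwistedQuotient.cohomology (globalEmbedding 2 F) (𝒰.hidaLevel r)
        (Representation.trivial O (GL (Fin 2) F) O) 2),
    c' ∈ TwistedQuotient.interiorCohomology (globalEmbedding 2 F) (𝒰.hidaLevel r)
        (Representation.trivial O (GL (Fin 2) F) O) P hP 2 →
    (∀ a : O, a • c' = 0 → a = 0) →
    ∀ (b : HeightOneSpectrum (𝓞 F) → ℕ → O),
    (∀ w ∉ 𝒰.bad, ∀ i : ℕ,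
      TwistedQuotient.heckeEnd (globalEmbedding 2 F) (𝒰.hidaLevel r)
        (Representation.trivial O (GL (Fin 2) F) O) (heckeElement 2 F w i) 2 c' = b w i • c') →
    (∀ w ∉ 𝒰.bad, ∀ 𝔓 ∈ w.primesAbove, ∀ σ : absoluteGaloisGroup F, IsArithFrobAt (𝓞 F) σ 𝔓 →
      (b w 1 - ((ρ₀ σ).val 0 0 + (ρ₀ σ).val 1 1) : O) ∈ maximalIdeal O) →
    (∀ v : HeightOneSpectrum (𝓞 F), (p : 𝓞 F) ∈ v.asIdeal → ∀ ϖ : (v.adicCompletion F)ˣ,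
      Valued.v (ϖ : v.adicCompletion F) = WithZero.exp (-1 : ℤ) →
      ∃ u : O, TwistedQuotient.heckeEnd (globalEmbedding 2 F) (𝒰.hidaLevel r)
          (Representation.trivial O (GL (Fin 2) F) O)
          (glDiagonal 2 (FiniteAdeleRing (𝓞 F) F)
            (fun i => if i.val < 1 then uniformizerIdele F v ϖ else 1)) 2 c' = u • c' ∧
        (u - (η (uniformizerIdele F v ϖ) : Oˣ) : O) ∈ maximalIdeal O) →
    ∀ (r' : FramedGaloisRep F (PadicAlgCl p) 2), r'.toGaloisRep.IsIrreducible →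
    𝒰.IsPadicallyAutomorphic r' →
    (∀ w ∉ 𝒰.bad, ∀ 𝔓 ∈ w.primesAbove, ∀ σ : absoluteGaloisGroup F, IsArithFrobAt (𝓞 F) σ 𝔓 →
      (r' σ).val.trace = ((b w 1 : O) : PadicAlgCl p)) →
    ∃ (r'' : FramedGaloisRep F (PadicAlgCl p) 2) (r₀ : absoluteGaloisGroup F →* GL (Fin 2) O),
      r''.toGaloisRep.IsIrreducible ∧ 𝒰.IsPadicallyAutomorphic r'' ∧
      r''.HasUpperTriangularIntegralModel r₀ ∧
      (∀ g, ((r₀ g).val 0 0 - (ρ₀ g).val 0 0 : O) ∈ maximalIdeal O ∧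
        ((r₀ g).val 1 1 - (ρ₀ g).val 1 1 : O) ∈ maximalIdeal O) ∧
      ∃ m : ℕ, 0 < m ∧ ∀ v : HeightOneSpectrum (𝓞 F), (p : 𝓞 F) ∈ v.asIdeal →
        ∃ Q : GL (Fin 2) (PadicAlgCl p), Valued.v (Q.val 0 0) ≤ Valued.v (Q.val 1 0) ∧
          ∀ σ, (Q⁻¹ * r''.toLocal v σ * Q).val 1 0 = 0 ∧ (σ ∈ absInertia (v.adicCompletion F) →
            (Q⁻¹ * r''.toLocal v σ * Q).val 1 1 ^ m = 1 ∧
            (Q⁻¹ * r''.toLocal v σ * Q).val 0 0 ^ m = algebraMap ℚ_[p] (PadicAlgCl p)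
              (((GaloisRep.cyclotomicCharacter (v.adicCompletion F) p σ).val : ℤ_[p]) : ℚ_[p]) ^
                ((2 - 1) * m)) := by
  sorry

/-! ## The model of the Tits building of `GL₂/F` used to instantiate the stubs: lines in `F²` -/

/-- Proper non-zero subspaces of `F²` (= lines = `ℙ¹(F)` = the Tits building of `GL₂/F`, a discrete
set), ordered by inclusion; the `F`-analogue of `GLnCohomology.ProperSubspace`. [folklore] -/
def ProperLine (F : Type) [Field F] : Type :=
  {W : Submodule F (Fin 2 → F) // W ≠ ⊥ ∧ W ≠ ⊤}

instance (F : Type) [Field F] : PartialOrder (ProperLine F) :=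
  inferInstanceAs (PartialOrder {W : Submodule F (Fin 2 → F) // W ≠ ⊥ ∧ W ≠ ⊤})

theorem map_mulVecLin_inv_map {F : Type} [Field F] (g : GL (Fin 2) F)
    (W : Submodule F (Fin 2 → F)) :
    (W.map (Matrix.mulVecLin (g : Matrix (Fin 2) (Fin 2) F))).map
      (Matrix.mulVecLin ((g⁻¹ : GL (Fin 2) F) : Matrix (Fin 2) (Fin 2) F)) = W := by
  rw [← Submodule.map_comp, ← Matrix.mulVecLin_mul, ← Units.val_mul, inv_mul_cancel, Units.val_one,
    Matrix.mulVecLin_one, Submodule.map_id]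

theorem map_mulVecLin_top {F : Type} [Field F] (g : GL (Fin 2) F) :
    (⊤ : Submodule F (Fin 2 → F)).map (Matrix.mulVecLin (g : Matrix (Fin 2) (Fin 2) F)) = ⊤ := by
  refine le_antisymm le_top ?_
  calc (⊤ : Submodule F (Fin 2 → F))
      = ((⊤ : Submodule F (Fin 2 → F)).map
          (Matrix.mulVecLin ((g⁻¹ : GL (Fin 2) F) : Matrix (Fin 2) (Fin 2) F))).map
          (Matrix.mulVecLin (((g⁻¹)⁻¹ : GL (Fin 2) F) : Matrix (Fin 2) (Fin 2) F)) :=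
        (map_mulVecLin_inv_map g⁻¹ ⊤).symm
    _ ≤ (⊤ : Submodule F (Fin 2 → F)).map (Matrix.mulVecLin (g : Matrix (Fin 2) (Fin 2) F)) := by
        rw [inv_inv]
        exact Submodule.map_mono le_top

/-- `GL₂(F)` acts on lines by `W ↦ gW`. [folklore] -/
instance (F : Type) [Field F] : MulAction (GL (Fin 2) F) (ProperLine F) where
  smul g W := ⟨W.1.map (Matrix.mulVecLin (g : Matrix (Fin 2) (Fin 2) F)),
    fun h => W.2.1 (by
      have h' := congrArg (Submodule.map
        (Matrix.mulVecLin ((g⁻¹ : GL (Fin 2) F) : Matrix (Fin 2) (Fin 2) F))) h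
      rwa [map_mulVecLin_inv_map, Submodule.map_bot] at h'),
    fun h => W.2.2 (by
      have h' := congrArg (Submodule.map
        (Matrix.mulVecLin ((g⁻¹ : GL (Fin 2) F) : Matrix (Fin 2) (Fin 2) F))) h
      rwa [map_mulVecLin_inv_map, map_mulVecLin_top] at h')⟩
  one_smul W := Subtype.ext (by
    change W.1.map (Matrix.mulVecLin ((1 : GL (Fin 2) F) : Matrix (Fin 2) (Fin 2) F)) = W.1
    rw [Units.val_one, Matrix.mulVecLin_one, Submodule.map_id])
  mul_smul g h W := Subtype.ext (by
    change W.1.map (Matrix.mulVecLin ((g * h : GL (Fin 2) F) : Matrix (Fin 2) (Fin 2) F)) =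
      (W.1.map (Matrix.mulVecLin (h : Matrix (Fin 2) (Fin 2) F))).map
        (Matrix.mulVecLin (g : Matrix (Fin 2) (Fin 2) F))
    rw [Units.val_mul, Matrix.mulVecLin_mul, Submodule.map_comp])

/-- Unfolding lemma for the action on lines. [folklore] -/
theorem coe_smul_properLine {F : Type} [Field F] (g : GL (Fin 2) F) (W : ProperLine F) :
    (g • W).1 = W.1.map (Matrix.mulVecLin (g : Matrix (Fin 2) (Fin 2) F)) :=
  rfl

/-- The action on lines is monotone (it is an action on a discrete poset). [folklore] -/
theorem properLine_smul_mono (F : Type) [Field F] (γ : GL (Fin 2) F) :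
    Monotone fun W : ProperLine F => γ • W :=
  fun _ _ h => Submodule.map_mono h

/-- `ProperLine F` IS the subtype of proper non-zero subspaces, equivariantly (identity). [folklore] -/
theorem properLine_isModel (F : Type) [Field F] :
    ∃ e : ProperLine F ≃o {W : Submodule F (Fin 2 → F) // W ≠ ⊥ ∧ W ≠ ⊤},
      ∀ (γ : GL (Fin 2) F) (x : ProperLine F), (e (γ • x)).1 = (e x).1.map (Matrix.mulVecLin γ.1) :=
  ⟨OrderIso.refl _, fun _ _ => rfl⟩

/-! ## The composition: the four stubs imply the crux BY NAME -/

/-- **Composition (the skeleton theorem).** Uses the four declared stubs BY NAME and nothing else —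
`stub_window → stub_lift → stub_galois → stub_orientation → crux`: instantiate
the Tits-building model with `ProperLine F`; feed the window's congruence data to the lift as the
target relation `A` (trace targets on `t_{w,1}`, `η`-targets on the `t_v(ϖ')`, nothing else); read
off the eigenvalues `b w i` by choice; build `r'` (galois) and the oriented integral model
(orientation); assemble the crux's conclusion with `k' = 2` and the window's level clause. -/
theorem EisensteinProModularSeed_of : EisensteinProModularSeed := by
  intro F _ _ hF hdeg p _ hp O hO ρ ρ₀ hirr hunr hmod hloc
  classical
  -- distinguishedness at the places above `p`, read off the local clause
  have hdist : ∀ v : HeightOneSpectrum (𝓞 F), (p : 𝓞 F) ∈ v.asIdeal → IsPDistinguishedAt ρ₀ v := by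
    obtain ⟨k, -, m, -, hv⟩ := hloc
    exact fun v hpv => (hv v hpv).1
  -- (1) the window, on the model `ProperLine F`
  obtain ⟨𝒰, q, r, η, c, hmax, hneat, hlev, hηo, hηF, hηfrob, hcint, hcprim, hcT, hcU⟩ :=
    stub_window F hF hdeg p hp O hO ρ ρ₀ hirr hunr hmod hloc (ProperLine F) (properLine_smul_mono F)
      (properLine_isModel F)
  -- (2) the lift, with the window's congruences as target relation
  obtain ⟨c', hc'int, hc'tf, hc'eig⟩ :=
    stub_lift F hF hdeg p hp O hO (ProperLine F) (properLine_smul_mono F) (properLine_isModel F) 𝒰 r hmax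
      hneat (fun g => {a | (∃ w, w ∉ 𝒰.bad ∧ g = heckeElement 2 F w 1 ∧ ∃ 𝔓, 𝔓 ∈ w.primesAbove ∧
          ∃ σ : absoluteGaloisGroup F, IsArithFrobAt (𝓞 F) σ 𝔓 ∧
            a = (ρ₀ σ).val 0 0 + (ρ₀ σ).val 1 1) ∨
        (∃ v : HeightOneSpectrum (𝓞 F), (p : 𝓞 F) ∈ v.asIdeal ∧ ∃ ϖ : (v.adicCompletion F)ˣ,
          Valued.v (ϖ : v.adicCompletion F) = WithZero.exp (-1 : ℤ) ∧
          g = glDiagonal 2 (FiniteAdeleRing (𝓞 F) F)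
            (fun i => if i.val < 1 then uniformizerIdele F v ϖ else 1) ∧
          a = ((η (uniformizerIdele F v ϖ) : Oˣ) : O))})
      ⟨c, hcint, hcprim, by
        intro g a ha
        rcases ha with ⟨w, hw, rfl, 𝔓, h𝔓, σ, hσ, rfl⟩ | ⟨v, hv, ϖ, hϖ, rfl, rfl⟩
        · exact hcT w hw 𝔓 h𝔓 σ hσ
        · exact hcU v hv ϖ hϖ⟩
  -- (3) the eigenvalues of `c'` on the spherical operators
  have hsph := fun (w : HeightOneSpectrum (𝓞 F)) (hw : w ∉ 𝒰.bad) (i : ℕ) =>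
    hc'eig (heckeElement 2 F w i) (Or.inl ⟨w, hw, i, rfl⟩)
  choose! b hb using hsph
  have hbeig : ∀ w ∉ 𝒰.bad, ∀ i : ℕ,
      TwistedQuotient.heckeEnd (globalEmbedding 2 F) (𝒰.hidaLevel r)
        (Representation.trivial O (GL (Fin 2) F) O) (heckeElement 2 F w i) 2 c' = b w i • c' :=
    fun w hw i => (hb w hw i).1
  have hbtr : ∀ w ∉ 𝒰.bad, ∀ 𝔓 ∈ w.primesAbove, ∀ σ : absoluteGaloisGroup F,
      IsArithFrobAt (𝓞 F) σ 𝔓 → (b w 1 - ((ρ₀ σ).val 0 0 + (ρ₀ σ).val 1 1) : O) ∈ maximalIdeal O :=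
    fun w hw 𝔓 h𝔓 σ hσ => (hb w hw 1).2 _ (Or.inl ⟨w, hw, rfl, 𝔓, h𝔓, σ, hσ, rfl⟩)
  have hbU : ∀ v : HeightOneSpectrum (𝓞 F), (p : 𝓞 F) ∈ v.asIdeal → ∀ ϖ : (v.adicCompletion F)ˣ,
      Valued.v (ϖ : v.adicCompletion F) = WithZero.exp (-1 : ℤ) →
      ∃ u : O, TwistedQuotient.heckeEnd (globalEmbedding 2 F) (𝒰.hidaLevel r)
          (Representation.trivial O (GL (Fin 2) F) O)
          (glDiagonal 2 (FiniteAdeleRing (𝓞 F) F)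
            (fun i => if i.val < 1 then uniformizerIdele F v ϖ else 1)) 2 c' = u • c' ∧
        (u - (η (uniformizerIdele F v ϖ) : Oˣ) : O) ∈ maximalIdeal O := by
    intro v hv ϖ hϖ
    obtain ⟨u, hu, hu'⟩ := hc'eig _ (Or.inr ⟨v, hv, ϖ, hϖ, rfl⟩)
    exact ⟨u, hu, hu' _ (Or.inr ⟨v, hv, ϖ, hϖ, rfl, rfl⟩)⟩
  -- (4) the Galois representation and (5) its oriented integral model
  obtain ⟨r', hirr', hpa', htr'⟩ :=
    stub_galois F hF hdeg p hp O hO (ProperLine F) (properLine_smul_mono F) (properLine_isModel F) 𝒰 r hmax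
      c' hc'int hc'tf b hbeig
  obtain ⟨r'', r₀, hirr'', hpa'', hmod'', hdiag'', m, hm, hord''⟩ :=
    stub_orientation F hF hdeg p hp O hO ρ ρ₀ hmod hdist (ProperLine F) (properLine_smul_mono F)
      (properLine_isModel F) 𝒰 r hmax η hηo hηF hηfrob c' hc'int hc'tf b hbeig hbtr hbU r' hirr'
      hpa' htr'
  -- (6) the crux's conclusion, weight `k' = 2`, level clause from the window
  exact ⟨𝒰, r'', r₀, q, hirr'', hpa'', hmod'', hdiag'', ⟨2, le_rfl, m, hm, hord''⟩, hlev⟩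

end Summit.Langlands.Langlands.Cruxes.EisensteinProModularSeed.ParallelH2EisensteinSymbol
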